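import Summits.Parity.GeneralizedHardyLittlewood.Theses.LeeYangFibres
import Summits.Parity.GeneralizedHardyLittlewood.Theorems.LeeYangFibresAbsoluteUpgradeSiegelGuard
import Summits.Parity.GeneralizedHardyLittlewood.Theorems.LeeYangFibresRelativeDimOne
import Literature.Barriers.Parity.SiegelZeroDichotomyNoSiegelZeros
import HarnessLib

/-!
# Crux `AbsoluteUpgrade` (stmt-Parity-14116) in the illusory world

`AbsoluteUpgrade := RelativeDimOne → DimOne`.  Consequences of the Siegel guard
(`stub_siegelGuard : MatomakiMerikoski2023_pairCorrelation → RelativeDimOne → ¬UnboundedSiegelZeros`,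
Theorems/LeeYangFibresAbsoluteUpgradeSiegelGuard.lean), all modulo the vendored theorem of
Matomäki–Merikoski (Theorem 1.3) taken as a hypothesis:

* `not_relativeDimOne_of_unboundedSiegelZeros`, `not_dimOne_of_unboundedSiegelZeros` — Siegel zeros of
  unbounded quality refute BOTH ends of the crux (the relative law directly, the absolute law because
  `DimOne → RelativeDimOne`, `relativeDimOne_of_dimOne`);
* `absoluteUpgrade_of_unboundedSiegelZeros` — hence in the illusory world the crux holds VACUOUSLY;
* `noSiegelZeros_of_relativeDimOne` — the guard in its strongest tree form: `RelativeDimOne` implies the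
  no-Siegel-zeros conjecture rh.S34 (`Literature.NumberTheory.LFunctions.NoSiegelZeros`), via
  `noSiegelZeros_iff_not_unboundedSiegelZeros` (Literature/Barriers/Parity/SiegelZeroDichotomyNoSiegelZeros.lean).

So, unlike the sibling residual `PairsToGHL` (false in the illusory world as soon as the routes deliver
fixed-shift pairs, Theorems/PairsToGHL/Negative/UnboundedSiegelZeros.lean), this crux admits NO
Siegel-zero-based refutation: any disproof of `AbsoluteUpgrade` must first bound the quality of Siegel zeros
(it must PROVE `RelativeDimOne`).  Conversely any proof may assume `¬UnboundedSiegelZeros` for free.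
-/

noncomputable section

namespace Summit.Parity.GeneralizedHardyLittlewood.Theorems.AbsoluteUpgrade

open Literature.NumberTheory.Sieve Literature.Barriers.Parity
open Summit.Parity.GeneralizedHardyLittlewood.Theses.LeeYangFibres (DimOne RelativeDimOne AbsoluteUpgrade)
open Summit.Parity.GeneralizedHardyLittlewood.Theorems.LeeYangFibresRelativeDimOne (relativeDimOne_of_dimOne)

/-- **Siegel zeros of unbounded quality refute relative Dickson–Hardy–Littlewood** (contrapositive of the
Siegel guard), modulo Matomäki–Merikoski Theorem 1.3. [cite: MatomakiMerikoski2023, Theorem 1.3] -/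
theorem not_relativeDimOne_of_unboundedSiegelZeros (hMM : MatomakiMerikoski2023_pairCorrelation)
    (hU : UnboundedSiegelZeros) : ¬ RelativeDimOne :=
  fun hR => stub_siegelGuard hMM hR hU

/-- **Siegel zeros of unbounded quality refute `DimOne`** (the `d = 1` case of Green–Tao's Conjecture 1.2 as
typed, shift-uniform), modulo Matomäki–Merikoski Theorem 1.3: `DimOne → RelativeDimOne`
(`relativeDimOne_of_dimOne`). [cite: MatomakiMerikoski2023, Theorem 1.3] [cite: GreenTao2010, Conj. 1.2] -/
theorem not_dimOne_of_unboundedSiegelZeros (hMM : MatomakiMerikoski2023_pairCorrelation)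
    (hU : UnboundedSiegelZeros) : ¬ DimOne :=
  fun hD => not_relativeDimOne_of_unboundedSiegelZeros hMM hU (relativeDimOne_of_dimOne hD)

/-- **In the illusory world the crux holds vacuously**: modulo Matomäki–Merikoski Theorem 1.3,
`UnboundedSiegelZeros → AbsoluteUpgrade` (its hypothesis `RelativeDimOne` fails there).  Hence no
Siegel-zero-based refutation of `AbsoluteUpgrade` exists; a disproof must prove `RelativeDimOne`, and a proof
may assume `¬UnboundedSiegelZeros`. [cite: MatomakiMerikoski2023, Theorem 1.3] -/
theorem absoluteUpgrade_of_unboundedSiegelZeros (hMM : MatomakiMerikoski2023_pairCorrelation)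
    (hU : UnboundedSiegelZeros) : AbsoluteUpgrade := by
  unfold AbsoluteUpgrade
  intro hR
  exact absurd hU (stub_siegelGuard hMM hR)

/-- **Relative Dickson–Hardy–Littlewood implies the no-Siegel-zeros conjecture rh.S34** (modulo
Matomäki–Merikoski Theorem 1.3): some `c > 0` with `L(σ, χ) ≠ 0` for `σ > 1 - c/log q`, all `q ≥ 3` and all
real primitive `χ mod q`.  The guard gives bounded quality at large conductors; small conductors are
continuity of `L(s, χ)` at `s = 1` (`noSiegelZeros_of_not_unboundedSiegelZeros`).
[cite: MatomakiMerikoski2023, Theorem 1.3] -/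
theorem noSiegelZeros_of_relativeDimOne :
    MatomakiMerikoski2023_pairCorrelation → RelativeDimOne → Literature.NumberTheory.LFunctions.NoSiegelZeros :=
  fun hMM hR => noSiegelZeros_of_not_unboundedSiegelZeros (stub_siegelGuard hMM hR)

/-- **The crux is equivalent to its Siegel-guarded form** (modulo Matomäki–Merikoski Theorem 1.3): proving
`AbsoluteUpgrade` under the extra hypothesis `NoSiegelZeros` (rh.S34) proves it outright, because
`RelativeDimOne` supplies that hypothesis. [cite: MatomakiMerikoski2023, Theorem 1.3] -/
theorem absoluteUpgrade_iff_guarded (hMM : MatomakiMerikoski2023_pairCorrelation) :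
    AbsoluteUpgrade ↔
      (Literature.NumberTheory.LFunctions.NoSiegelZeros → RelativeDimOne → DimOne) := by
  unfold AbsoluteUpgrade
  constructor
  · intro h _ hR
    exact h hR
  · intro h hR
    exact h (noSiegelZeros_of_relativeDimOne hMM hR) hR

end Summit.Parity.GeneralizedHardyLittlewood.Theorems.AbsoluteUpgrade

end
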